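import Literature.Probability.LatticeModels.SixVertexSpectralMeasureConvergence
import Mathlib.MeasureTheory.Measure.Prokhorov
import Mathlib.MeasureTheory.Measure.LevyProkhorovMetric

/-!
# The space `𝓜_{c,C}` is sequentially compact (DKLM 2026, Part II, Lemma 31 (i))

H. Duminil-Copin, K. K. Kozlowski, P. Lammers, I. Manolescu, *Gaussian free field convergence of
the six-vertex model with `-1 ≤ Δ ≤ -1/2`*, arXiv:2603.06268 (2026) [DKLM2026SixVertexGFF]
(`paper:arxiv-2603.06268`, chunks p0023–p0024):

> **Lemma 31** (Properties of `𝓜`). (i) `𝓜` is a compact topological space, […]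
>
> **Definition 33** (Convergence sequence). […] Convergence sequences exist by compactness of
> `𝓜`. Moreover, from any sequence of scales `(δ_n')_n` tending to zero, one may extract a
> convergence sub-sequence `(δ_n)_n`.

We prove (i) in the sequential form that is used in the paper: **every sequence in `𝓜_{c,C}`
has a subsequence converging vaguely on `ℝ_{>0} × ℝ` to an element of `𝓜_{c,C}`**
(`dklmSpaceM_exists_subseq_vagueTendsto`). Proof: the weighted measures `(a ∧ 1/a) · ν_n` are
finite with mass `≤ 12C` (`dklmSpaceM_lintegral_min_inv_le`) and tight on `ℝ²` by the uniform
tail estimate `dklmSpaceM_lintegral_compl_tailRect_le`; Prokhorov's theorem (Mathlib, via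
normalisation to probability measures and the Lévy–Prokhorov metric) extracts a weakly convergent
subsequence with limit `ρ`; the vague limit is `ν := (a ∧ 1/a)⁻¹ · ρ|_{a > 0}`, and the defining
properties of `𝓜_{c,C}` pass to the limit (reflection invariance through the weak limit; the
bounds (i), (ii) — which concern open sets — by testing against Urysohn functions).
`IsConvergenceSeq` is Definition 33, and `exists_isConvergenceSeq_subseq` extracts convergence
sub-sequences from any sequence of scales (scale invariance of `𝓜`, `scaleMeasure_mem_dklmSpaceM`).

## References

* H. Duminil-Copin, K. K. Kozlowski, P. Lammers, I. Manolescu, arXiv:2603.06268 (2026), Part II,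
  Definition 29, Lemma 31 (i), Definition 33. [DKLM2026SixVertexGFF]
* P. Billingsley, *Convergence of Probability Measures*, 2nd ed., Thm. 5.1 (Prokhorov).
-/

noncomputable section

open MeasureTheory Set Filter Topology BoundedContinuousFunction
open scoped NNReal ENNReal

namespace Literature.Probability.LatticeModels.SixVertex

/-! ## 1. Sequential Prokhorov for tight sequences of finite measures -/

/-- **Sequential Prokhorov compactness** for a tight sequence of finite Borel measures of bounded
mass on a separable metrisable space: some subsequence converges weakly (in `FiniteMeasure`).
(Masses converge along a subsequence; if the limit is `0` the measures tend to `0`; otherwise the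
normalised probability measures form a tight family, whose closure is compact by Prokhorov's
theorem and sequentially compact by Lévy–Prokhorov metrisability.)
[cite: DKLM2026SixVertexGFF, Part II, Lemma 31 (i)] -/
theorem exists_subseq_tendsto_of_isTightMeasureSet {E : Type*} [MeasurableSpace E] [TopologicalSpace E]
    [TopologicalSpace.PseudoMetrizableSpace E] [TopologicalSpace.SeparableSpace E] [T2Space E] [BorelSpace E]
    [Nonempty E] {C : ℝ≥0} (μ : ℕ → FiniteMeasure E) (hC : ∀ n, (μ n).mass ≤ C)
    (ht : IsTightMeasureSet (Set.range fun n => (μ n : Measure E))) :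
    ∃ φ : ℕ → ℕ, StrictMono φ ∧ ∃ ν : FiniteMeasure E, Tendsto (μ ∘ φ) atTop (𝓝 ν) := by
  -- Step 1: the masses converge along a subsequence `φ₁`, to some `c ∈ [0, C]`
  obtain ⟨c, -, φ₁, hφ₁, hc⟩ := (isCompact_Icc (a := (0 : ℝ≥0)) (b := C)).tendsto_subseq
    (x := fun n => (μ n).mass) fun n => ⟨bot_le, hC n⟩
  by_cases hc0 : c = 0
  · subst hc0
    exact ⟨φ₁, hφ₁, 0, FiniteMeasure.tendsto_zero_of_tendsto_zero_mass hc⟩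
  -- Step 2 (`c ≠ 0`): along a further subsequence the masses are `≥ c/2`
  have hc2pos : (0 : ℝ≥0) < c / 2 := half_pos (pos_iff_ne_zero.2 hc0)
  have hc2 : (c / 2 : ℝ≥0) < c := NNReal.half_lt_self hc0
  obtain ⟨φ₂, hφ₂, hge⟩ := extraction_of_eventually_atTop (hc.eventually (lt_mem_nhds hc2))
  have hpos : ∀ n, (c / 2 : ℝ≥0) < (μ (φ₁ (φ₂ n))).mass := hge
  have hne' : ∀ n, μ (φ₁ (φ₂ n)) ≠ 0 := fun n =>
    (FiniteMeasure.mass_nonzero_iff _).1 (ne_of_gt (hc2pos.trans (hpos n)))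
  set P : ℕ → ProbabilityMeasure E := fun n => (μ (φ₁ (φ₂ n))).normalize with hP
  have hPle : ∀ n (s : Set E), (P n : Measure E) s ≤ ((c / 2)⁻¹ : ℝ≥0) * (μ (φ₁ (φ₂ n)) : Measure E) s := by
    intro n s
    rw [hP]
    dsimp only
    rw [FiniteMeasure.toMeasure_normalize_eq_of_nonzero _ (hne' n), Measure.smul_apply, ENNReal.smul_def,
      smul_eq_mul]
    gcongr
    exact (hpos n).le
  have hc2ne : ((c / 2 : ℝ≥0) : ℝ≥0∞) ≠ 0 := ENNReal.coe_ne_zero.2 hc2pos.ne'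
  have htight : IsTightMeasureSet {((Q : ProbabilityMeasure E) : Measure E) | Q ∈ Set.range P} := by
    rw [isTightMeasureSet_iff_exists_isCompact_measure_compl_le]
    intro ε hε
    have hε' : 0 < ε * (c / 2 : ℝ≥0) := ENNReal.mul_pos hε.ne' hc2ne
    obtain ⟨K, hK, hKμ⟩ := isTightMeasureSet_iff_exists_isCompact_measure_compl_le.1 ht _ hε'
    refine ⟨K, hK, ?_⟩
    rintro _ ⟨Q, ⟨n, rfl⟩, rfl⟩
    calc (P n : Measure E) Kᶜ ≤ ((c / 2)⁻¹ : ℝ≥0) * (μ (φ₁ (φ₂ n)) : Measure E) Kᶜ := hPle n _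
      _ ≤ ((c / 2)⁻¹ : ℝ≥0) * (ε * (c / 2 : ℝ≥0)) := by gcongr; exact hKμ _ ⟨φ₁ (φ₂ n), rfl⟩
      _ = ε := by
          rw [ENNReal.coe_inv hc2pos.ne', mul_comm ε, ← mul_assoc, ENNReal.inv_mul_cancel hc2ne ENNReal.coe_ne_top,
            one_mul]
  -- Step 3: Prokhorov and Lévy–Prokhorov metrisability give a weakly convergent subsequence
  obtain ⟨Q, -, ψ, hψ, hQ⟩ := (isCompact_closure_of_isTightMeasureSet htight).tendsto_subseq
    (x := P) fun n => subset_closure (mem_range_self n)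
  -- Step 4: recombine masses and normalised measures
  refine ⟨φ₁ ∘ φ₂ ∘ ψ, hφ₁.comp (hφ₂.comp hψ), c • Q.toFiniteMeasure, ?_⟩
  rw [FiniteMeasure.tendsto_iff_forall_integral_tendsto]
  intro g
  have h1 : ∀ n, ∫ x, g x ∂(μ n : Measure E) =
      (μ n).mass • ∫ x, g x ∂((μ n).normalize : Measure E) := by
    intro n
    conv_lhs => rw [(μ n).self_eq_mass_smul_normalize]
    rw [FiniteMeasure.toMeasure_smul, integral_smul_nnreal_measure]
    rfl
  have h2 : ∫ x, g x ∂((c • Q.toFiniteMeasure : FiniteMeasure E) : Measure E) =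
      c • ∫ x, g x ∂(Q : Measure E) := by
    rw [FiniteMeasure.toMeasure_smul, integral_smul_nnreal_measure]
    rfl
  simp_rw [Function.comp_apply, h1, h2]
  exact ((hc.comp hφ₂.tendsto_atTop).comp hψ.tendsto_atTop).smul
    ((ProbabilityMeasure.tendsto_iff_forall_integral_tendsto.1 hQ) g)

/-! ## 2. The weighted finite measures `(a ∧ 1/a) · ν` -/

variable {c C : ℝ} {ν : Measure (ℝ × ℝ)}

/-- The weight `w = a ∧ 1/a` as an `ℝ≥0∞`-valued density. [cite: DKLM2026SixVertexGFF, Part II §1.2.1] -/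
def weightW (p : ℝ × ℝ) : ℝ≥0∞ := ENNReal.ofReal (min p.1 p.1⁻¹)

/-- The inverse weight `(a ∧ 1/a)⁻¹` as an `ℝ≥0∞`-valued density. [cite: DKLM2026SixVertexGFF, Part II §1.2.1] -/
def weightWInv (p : ℝ × ℝ) : ℝ≥0∞ := ENNReal.ofReal (min p.1 p.1⁻¹)⁻¹

/-- `w` is measurable. [folklore] -/
theorem measurable_weightW : Measurable weightW := measurable_min_inv.ennreal_ofReal

/-- `w⁻¹` is measurable. [folklore] -/
theorem measurable_weightWInv : Measurable weightWInv := measurable_min_inv.inv.ennreal_ofReal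

/-- `w` is reflection invariant. [folklore] -/
theorem weightW_reflect (p : ℝ × ℝ) : weightW (p.1, -p.2) = weightW p := rfl

/-- `w⁻¹` is reflection invariant. [folklore] -/
theorem weightWInv_reflect (p : ℝ × ℝ) : weightWInv (p.1, -p.2) = weightWInv p := rfl

/-- **The weighted measure `(a ∧ 1/a) · ν` is finite** for `ν ∈ 𝓜_{c,C}`, of mass `≤ 12C`.
[cite: DKLM2026SixVertexGFF, Part II §1.2.1 (eq. after Lemma 30)] -/
theorem dklmSpaceM_withDensity_univ_le (h : ν ∈ dklmSpaceM c C) :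
    ν.withDensity weightW univ ≤ 12 * ENNReal.ofReal C := by
  rw [withDensity_apply _ MeasurableSet.univ, Measure.restrict_univ]
  exact dklmSpaceM_lintegral_min_inv_le h

/-- The weighted measure as a `FiniteMeasure`. [cite: DKLM2026SixVertexGFF, Part II §1.2.1] -/
def weightedFiniteMeasure (h : ν ∈ dklmSpaceM c C) : FiniteMeasure (ℝ × ℝ) :=
  ⟨ν.withDensity weightW, ⟨(dklmSpaceM_withDensity_univ_le h).trans_lt
    (ENNReal.mul_lt_top (by norm_num) ENNReal.ofReal_lt_top)⟩⟩

/-- Its underlying measure. [folklore] -/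
theorem toMeasure_weightedFiniteMeasure (h : ν ∈ dklmSpaceM c C) :
    ((weightedFiniteMeasure h : FiniteMeasure (ℝ × ℝ)) : Measure (ℝ × ℝ)) = ν.withDensity weightW := rfl

/-- Its mass is `≤ 12C`. [cite: DKLM2026SixVertexGFF, Part II §1.2.1] -/
theorem mass_weightedFiniteMeasure_le (h : ν ∈ dklmSpaceM c C) :
    (weightedFiniteMeasure h).mass ≤ (12 * ENNReal.ofReal C).toNNReal := by
  rw [← ENNReal.coe_le_coe, FiniteMeasure.ennreal_mass, toMeasure_weightedFiniteMeasure,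
    ENNReal.coe_toNNReal (ENNReal.mul_ne_top (by norm_num) ENNReal.ofReal_ne_top)]
  exact dklmSpaceM_withDensity_univ_le h

/-- **Choice of the tail rectangle**: for `η > 0` there are `J`, `B ≥ 2^{J+1}` with
`∫_{K_{J,B}ᶜ} (a ∧ 1/a) dν ≤ η` for all `ν ∈ 𝓜_{c,C}`.
[cite: DKLM2026SixVertexGFF, Part II, Definition 29 and Lemma 31] -/
theorem exists_tailRect_lintegral_le (hc : 0 < c) (hC : 0 ≤ C) {η : ℝ} (hη : 0 < η) :
    ∃ (J : ℕ) (B : ℝ), (2 : ℝ) ^ ((J : ℤ) + 1) ≤ B ∧ ∀ ν : Measure (ℝ × ℝ), ν ∈ dklmSpaceM c C →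
      ∫⁻ p in (tailRect J B)ᶜ, ENNReal.ofReal (min p.1 p.1⁻¹) ∂ν ≤ ENNReal.ofReal η := by
  obtain ⟨J, hJ⟩ : ∃ J : ℕ, (2⁻¹ : ℝ) ^ J < η / 2 / (16 * C + 1) :=
    exists_pow_lt_of_lt_one (by positivity) (by norm_num)
  have hJ' : 16 * C * (2⁻¹ : ℝ) ^ J ≤ η / 2 := by
    have h1 : 16 * C * (2⁻¹ : ℝ) ^ J ≤ (16 * C + 1) * (2⁻¹ : ℝ) ^ J := by gcongr; linarith
    have h2 : (16 * C + 1) * (2⁻¹ : ℝ) ^ J ≤ (16 * C + 1) * (η / 2 / (16 * C + 1)) := by gcongr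
    rw [mul_div_cancel₀ _ (by positivity : (16 * C + 1 : ℝ) ≠ 0)] at h2
    exact h1.trans h2
  set r : ℝ := (2⁻¹ : ℝ) ^ c with hr
  have hr1 : r < 1 := Real.rpow_lt_one (by norm_num) (by norm_num) hc
  have hr0 : 0 < 1 - r := by linarith
  set D : ℝ := 2 * C * (1 - r)⁻¹ + 1 with hD
  have hD0 : 0 < D := by positivity
  set sB : ℝ := min (η / 2 / D) 1 with hsB
  have hsB0 : 0 < sB := lt_min (by positivity) one_pos
  have hsB1 : sB ≤ 1 := min_le_right _ _
  set α : ℝ := (2 : ℝ) ^ ((J : ℤ) + 1) with hαdef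
  have hα0 : 0 < α := zpow_pos two_pos _
  set B : ℝ := α * sB ^ (-(1 / c)) with hBdef
  have hsBpow : 1 ≤ sB ^ (-(1 / c)) := Real.one_le_rpow_of_pos_of_le_one_of_nonpos hsB0 hsB1 (by
    rw [neg_nonpos]; positivity)
  have hαB : α ≤ B := le_mul_of_one_le_right hα0.le hsBpow
  have hquot : (α / B) ^ c = sB := by
    rw [hBdef, div_mul_cancel_left₀ hα0.ne', Real.rpow_neg hsB0.le, inv_inv, ← Real.rpow_mul hsB0.le,
      one_div_mul_cancel hc.ne', Real.rpow_one]
  have hBtail : 2 * (C * (α / B) ^ c) * (1 - r)⁻¹ ≤ η / 2 := by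
    rw [hquot, show 2 * (C * sB) * (1 - r)⁻¹ = (2 * C * (1 - r)⁻¹) * sB by ring]
    calc (2 * C * (1 - r)⁻¹) * sB ≤ D * sB := by gcongr; linarith
      _ ≤ D * (η / 2 / D) := by gcongr; exact min_le_left _ _
      _ = η / 2 := mul_div_cancel₀ _ hD0.ne'
  refine ⟨J, B, hαB, fun ν h => ?_⟩
  have hfin : ∫⁻ p in (tailRect J B)ᶜ, ENNReal.ofReal (min p.1 p.1⁻¹) ∂ν ≠ ⊤ :=
    ((setLIntegral_le_lintegral _ _).trans_lt ((dklmSpaceM_lintegral_min_inv_le h).trans_lt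
      (ENNReal.mul_lt_top (by norm_num) ENNReal.ofReal_lt_top))).ne
  rw [ENNReal.le_ofReal_iff_toReal_le hfin hη.le]
  have h3 := dklmSpaceM_toReal_lintegral_compl_tailRect_le h hc hC J hαB
  simp only [← hαdef, ← hr] at h3
  linarith [hJ', hBtail]

/-- **The weighted family is tight** on `ℝ²`: uniformly small weighted mass outside the compact
rectangles `K_{J,B}`. [cite: DKLM2026SixVertexGFF, Part II, Lemma 31 (i)] -/
theorem isTightMeasureSet_weighted (hc : 0 < c) (hC : 0 ≤ C) {νs : ℕ → Measure (ℝ × ℝ)}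
    (hνs : ∀ n, νs n ∈ dklmSpaceM c C) :
    IsTightMeasureSet (Set.range fun n => ((weightedFiniteMeasure (hνs n) : FiniteMeasure (ℝ × ℝ)) : Measure (ℝ × ℝ))) := by
  rw [isTightMeasureSet_iff_exists_isCompact_measure_compl_le]
  intro ε hε
  rcases eq_or_ne ε ⊤ with rfl | hεtop
  · exact ⟨∅, isCompact_empty, fun μ _ => le_top⟩
  have hε' : 0 < ε.toReal := ENNReal.toReal_pos hε.ne' hεtop
  obtain ⟨J, B, hB, hJB⟩ := exists_tailRect_lintegral_le hc hC hε'
  refine ⟨tailRect J B, isCompact_tailRect J B, ?_⟩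
  rintro _ ⟨n, rfl⟩
  dsimp only
  rw [toMeasure_weightedFiniteMeasure, withDensity_apply _ (measurableSet_tailRect J B).compl]
  exact (hJB _ (hνs n)).trans (le_of_eq (ENNReal.ofReal_toReal hεtop))


/-! ## 3. Test functions against weighted measures and the candidate limit -/

/-- The reflection `(a, b) ↦ (a, -b)`. [cite: DKLM2026SixVertexGFF, Part II, Definition 29] -/
def reflectB (p : ℝ × ℝ) : ℝ × ℝ := (p.1, -p.2)

/-- The reflection is continuous. [folklore] -/
theorem continuous_reflectB : Continuous reflectB := continuous_fst.prodMk continuous_snd.neg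

/-- The reflection is measurable. [folklore] -/
theorem measurable_reflectB : Measurable reflectB := continuous_reflectB.measurable

/-- The reflection as a bundled continuous map. [folklore] -/
def reflectBC : C(ℝ × ℝ, ℝ × ℝ) := ⟨reflectB, continuous_reflectB⟩

/-- Unfolding the bundled reflection. [folklore] -/
@[simp] theorem reflectBC_apply (p : ℝ × ℝ) : reflectBC p = reflectB p := rfl

/-- **Change of variables for densities**: `R_* (μ · (v ∘ R)) = (R_* μ) · v`. [folklore] -/
theorem map_withDensity_comp {μ : Measure (ℝ × ℝ)} {R : ℝ × ℝ → ℝ × ℝ} (hR : Measurable R)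
    {v : ℝ × ℝ → ℝ≥0∞} (hv : Measurable v) :
    (μ.withDensity (v ∘ R)).map R = (μ.map R).withDensity v := by
  ext s hs
  rw [Measure.map_apply hR hs, withDensity_apply _ (hR hs), withDensity_apply _ hs, setLIntegral_map hs hv hR]
  rfl

/-- A product `θ · f` with `θ` continuous on an open set `U` and `f` continuous with support inside
`U` is continuous everywhere (real-valued version). [folklore] -/
theorem continuous_mul_of_tsupport_subset {U : Set (ℝ × ℝ)} (hU : IsOpen U) {θ : ℝ × ℝ → ℝ}
    (hθ : ContinuousOn θ U) {f : ℝ × ℝ → ℝ} (hf : Continuous f) (hsub : tsupport f ⊆ U) :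
    Continuous fun p => θ p * f p := by
  rw [continuous_iff_continuousAt]
  intro x
  by_cases hx : x ∈ U
  · exact (hθ.continuousAt (hU.mem_nhds hx)).mul hf.continuousAt
  · have hx' : x ∉ tsupport f := fun h' => hx (hsub h')
    rw [notMem_tsupport_iff_eventuallyEq] at hx'
    have heq : (fun _ => (0 : ℝ)) =ᶠ[𝓝 x] fun p => θ p * f p := hx'.mono fun p hp => by simp [hp]
    exact continuousAt_const.congr heq

/-- `(a ∧ 1/a)⁻¹` is continuous on the half-plane. [folklore] -/
theorem continuousOn_min_inv_inv : ContinuousOn (fun p : ℝ × ℝ => (min p.1 p.1⁻¹)⁻¹) {p : ℝ × ℝ | 0 < p.1} := by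
  have hmin : ContinuousOn (fun p : ℝ × ℝ => min p.1 p.1⁻¹) {p : ℝ × ℝ | 0 < p.1} :=
    continuous_min.comp_continuousOn (continuousOn_fst.prodMk (continuousOn_fst.inv₀ fun p hp => ne_of_gt hp))
  exact hmin.inv₀ fun p hp => (min_inv_pos hp).ne'

/-- **The divided test function `ψ = φ / (a ∧ 1/a)`** of a test function `φ ∈ C_c(ℝ_{>0} × ℝ)`, as a
bounded continuous function on `ℝ²`. [cite: DKLM2026SixVertexGFF, Part II, Lemma 31 (i)] -/
theorem exists_bcf_div_weight {φ : ℝ × ℝ → ℝ} (hφ : Continuous φ) (hsupp : HasCompactSupport φ)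
    (hsub : tsupport φ ⊆ {p : ℝ × ℝ | 0 < p.1}) :
    ∃ ψ : (ℝ × ℝ) →ᵇ ℝ, ∀ p, ψ p = (min p.1 p.1⁻¹)⁻¹ * φ p := by
  have hc : Continuous fun p : ℝ × ℝ => (min p.1 p.1⁻¹)⁻¹ * φ p :=
    continuous_mul_of_tsupport_subset isOpen_pos continuousOn_min_inv_inv hφ hsub
  have hcs : HasCompactSupport fun p : ℝ × ℝ => (min p.1 p.1⁻¹)⁻¹ * φ p := hsupp.mul_left
  obtain ⟨Cψ, hCψ⟩ := hcs.exists_bound_of_continuous hc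
  exact ⟨BoundedContinuousFunction.ofNormedAddCommGroup _ hc Cψ hCψ, fun p => rfl⟩

/-- **Testing `ν` against `φ` is testing `(a ∧ 1/a)·ν` against `φ/(a ∧ 1/a)`.**
[cite: DKLM2026SixVertexGFF, Part II, Lemma 31 (i)] -/
theorem integral_eq_integral_withDensity_weightW (ν : Measure (ℝ × ℝ)) {φ : ℝ × ℝ → ℝ}
    (hsub : tsupport φ ⊆ {p : ℝ × ℝ | 0 < p.1}) :
    ∫ p, φ p ∂ν = ∫ p, (min p.1 p.1⁻¹)⁻¹ * φ p ∂ν.withDensity weightW := by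
  rw [integral_withDensity_eq_integral_toReal_smul measurable_weightW (ae_of_all _ fun _ => ENNReal.ofReal_lt_top)]
  refine integral_congr_ae (ae_of_all _ fun p => ?_)
  simp only [weightW, smul_eq_mul]
  by_cases hp : 0 < p.1
  · rw [ENNReal.toReal_ofReal (min_inv_pos hp).le, ← mul_assoc, mul_inv_cancel₀ (min_inv_pos hp).ne', one_mul]
  · have : φ p = 0 := image_eq_zero_of_notMem_tsupport fun h' => hp (hsub h')
    simp [this]

/-- **The candidate vague limit** `ν := (a ∧ 1/a)⁻¹ · ρ|_{a > 0}` attached to a finite measure `ρ`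
on `ℝ²` (the weak limit of the weighted measures). [cite: DKLM2026SixVertexGFF, Part II, Lemma 31 (i)] -/
def vagueLimitMeasure (ρ : Measure (ℝ × ℝ)) : Measure (ℝ × ℝ) :=
  (ρ.restrict {p : ℝ × ℝ | 0 < p.1}).withDensity weightWInv

/-- Testing the candidate limit: `∫ φ dν = ∫ φ/(a ∧ 1/a) dρ`. [cite: DKLM2026SixVertexGFF, Part II, Lemma 31 (i)] -/
theorem integral_vagueLimitMeasure (ρ : Measure (ℝ × ℝ)) {φ : ℝ × ℝ → ℝ}
    (hsub : tsupport φ ⊆ {p : ℝ × ℝ | 0 < p.1}) :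
    ∫ p, φ p ∂vagueLimitMeasure ρ = ∫ p, (min p.1 p.1⁻¹)⁻¹ * φ p ∂ρ := by
  rw [vagueLimitMeasure,
    integral_withDensity_eq_integral_toReal_smul measurable_weightWInv (ae_of_all _ fun _ => ENNReal.ofReal_lt_top),
    setIntegral_congr_fun measurableSet_pos (g := fun p : ℝ × ℝ => (min p.1 p.1⁻¹)⁻¹ * φ p) (fun p hp => by
      simp only [weightWInv, smul_eq_mul]
      rw [ENNReal.toReal_ofReal (inv_nonneg.2 (min_inv_pos hp).le)])]
  refine setIntegral_eq_integral_of_forall_compl_eq_zero fun p hp => ?_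
  have : φ p = 0 := image_eq_zero_of_notMem_tsupport fun h' => hp (hsub h')
  simp [this]

/-- The candidate limit gives no mass to `{a ≤ 0}`. [cite: DKLM2026SixVertexGFF, Part II, Definition 29] -/
theorem vagueLimitMeasure_nonpos (ρ : Measure (ℝ × ℝ)) : vagueLimitMeasure ρ {p : ℝ × ℝ | p.1 ≤ 0} = 0 := by
  refine withDensity_absolutelyContinuous _ _ ?_
  rw [Measure.restrict_apply (measurableSet_le measurable_fst measurable_const)]
  convert measure_empty (μ := ρ)
  ext p
  simp only [mem_inter_iff, mem_setOf_eq, mem_empty_iff_false, iff_false, not_and, not_lt]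
  exact fun h => h

/-- The candidate limit is finite on compact subsets of the half-plane. [cite: DKLM2026SixVertexGFF, Part II, Lemma 31 (i)] -/
theorem vagueLimitMeasure_compact_lt_top (ρ : Measure (ℝ × ℝ)) [IsFiniteMeasure ρ] {K : Set (ℝ × ℝ)}
    (hK : IsCompact K) (hKU : K ⊆ {p : ℝ × ℝ | 0 < p.1}) : vagueLimitMeasure ρ K < ⊤ := by
  obtain ⟨Cb, hCb⟩ := hK.exists_bound_of_continuousOn (continuousOn_min_inv_inv.mono hKU)
  rw [vagueLimitMeasure, withDensity_apply _ hK.measurableSet]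
  calc ∫⁻ p in K, weightWInv p ∂ρ.restrict {p : ℝ × ℝ | 0 < p.1}
      ≤ ∫⁻ _ in K, ENNReal.ofReal Cb ∂ρ.restrict {p : ℝ × ℝ | 0 < p.1} := by
        refine setLIntegral_mono' hK.measurableSet fun p hp => ?_
        exact ENNReal.ofReal_le_ofReal ((le_abs_self _).trans ((Real.norm_eq_abs _).symm.le.trans (hCb p hp)))
    _ = ENNReal.ofReal Cb * (ρ.restrict {p : ℝ × ℝ | 0 < p.1}) K := setLIntegral_const _ _
    _ < ⊤ := ENNReal.mul_lt_top ENNReal.ofReal_lt_top (measure_lt_top _ _)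

/-- The reflected candidate limit: if `ρ` is reflection invariant, so is `ν`.
[cite: DKLM2026SixVertexGFF, Part II, Lemma 31 (i)] -/
theorem vagueLimitMeasure_map_reflect {ρ : Measure (ℝ × ℝ)} (hρ : ρ.map reflectB = ρ) :
    (vagueLimitMeasure ρ).map reflectB = vagueLimitMeasure ρ := by
  have hmap : (ρ.restrict {p : ℝ × ℝ | 0 < p.1}).map reflectB = ρ.restrict {p : ℝ × ℝ | 0 < p.1} := by
    have h1 := (Measure.restrict_map measurable_reflectB measurableSet_pos (μ := ρ)).symm
    rw [hρ] at h1
    exact h1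
  calc (vagueLimitMeasure ρ).map reflectB
      = ((ρ.restrict {p : ℝ × ℝ | 0 < p.1}).withDensity (weightWInv ∘ reflectB)).map reflectB := rfl
    _ = ((ρ.restrict {p : ℝ × ℝ | 0 < p.1}).map reflectB).withDensity weightWInv :=
        map_withDensity_comp measurable_reflectB measurable_weightWInv
    _ = vagueLimitMeasure ρ := by rw [hmap]; rfl

/-! ## 4. Bounds on open sets pass to vague limits -/

/-- A compact exhaustion of an open subset of `ℝ²`. [folklore] -/
theorem exists_compact_exhaustion {G : Set (ℝ × ℝ)} (hG : IsOpen G) :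
    ∃ K : ℕ → Set (ℝ × ℝ), (∀ j, IsCompact (K j)) ∧ (∀ j, K j ⊆ G) ∧ Monotone K ∧ ⋃ j, K j = G := by
  obtain ⟨F, hFc, hFs, hFu, hFm⟩ := hG.exists_iUnion_isClosed
  refine ⟨fun j => F j ∩ Metric.closedBall 0 j, fun j => (isCompact_closedBall _ _).inter_left (hFc j),
    fun j => inter_subset_left.trans (hFs j), fun i j hij => inter_subset_inter (hFm hij)
      (Metric.closedBall_subset_closedBall (by exact_mod_cast hij)), ?_⟩
  refine subset_antisymm (iUnion_subset fun j => inter_subset_left.trans (hFs j)) fun p hp => ?_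
  rw [← hFu] at hp
  obtain ⟨j₀, hj₀⟩ := mem_iUnion.1 hp
  obtain ⟨j₁, hj₁⟩ := exists_nat_ge (dist p 0)
  refine mem_iUnion.2 ⟨max j₀ j₁, hFm (le_max_left _ _) hj₀, ?_⟩
  rw [Metric.mem_closedBall]
  exact hj₁.trans (by exact_mod_cast le_max_right j₀ j₁)

/-- **Bounds on open subsets of the half-plane pass to vague limits**: if `ν_n → ν` vaguely on
`ℝ_{>0} × ℝ`, `ν` is finite on compact subsets of the half-plane, `G ⊆ ℝ_{>0} × ℝ` is open and
`ν_n(G) ≤ b` for all `n`, then `ν(G) ≤ b` (test against Urysohn functions of a compact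
exhaustion of `G`). [cite: DKLM2026SixVertexGFF, Part II, Lemma 31 (i)] -/
theorem measure_le_of_halfPlaneVagueTendsto {μs : ℕ → Measure (ℝ × ℝ)} {νlim : Measure (ℝ × ℝ)}
    (hv : HalfPlaneVagueTendsto μs νlim)
    (hfin : ∀ K : Set (ℝ × ℝ), IsCompact K → K ⊆ {p : ℝ × ℝ | 0 < p.1} → νlim K < ⊤)
    {G : Set (ℝ × ℝ)} (hG : IsOpen G) (hGU : G ⊆ {p : ℝ × ℝ | 0 < p.1}) {b : ℝ} (hb : 0 ≤ b)
    (hle : ∀ n, μs n G ≤ ENNReal.ofReal b) : νlim G ≤ ENNReal.ofReal b := by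
  obtain ⟨K, hKc, hKG, hKm, hKu⟩ := exists_compact_exhaustion hG
  rw [← hKu, hKm.measure_iUnion]
  refine iSup_le fun j => ?_
  -- a Urysohn function for `K j` supported in an open set with compact closure inside `G`
  obtain ⟨r, hr⟩ : ∃ r : ℝ, K j ⊆ Metric.ball 0 r := (hKc j).isBounded.subset_ball 0
  set s : Set (ℝ × ℝ) := G ∩ Metric.ball 0 r with hs
  have hso : IsOpen s := hG.inter Metric.isOpen_ball
  have hKs : K j ⊆ s := subset_inter (hKG j) hr
  have hsc : IsCompact (closure s) := (isCompact_closedBall (0 : ℝ × ℝ) r).of_isClosed_subset isClosed_closure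
    (closure_minimal (inter_subset_right.trans Metric.ball_subset_closedBall) Metric.isClosed_closedBall)
  obtain ⟨f, hfs, hf1, hf01⟩ := exists_tsupport_one_of_isOpen_isClosed hso hsc (hKc j).isClosed hKs
  have hfG : tsupport f ⊆ G := hfs.trans inter_subset_left
  have hfU : tsupport f ⊆ {p : ℝ × ℝ | 0 < p.1} := hfG.trans hGU
  have hfsupp : HasCompactSupport f := hsc.of_isClosed_subset (isClosed_tsupport _) (hfs.trans subset_closure)
  have hf0 : ∀ p, 0 ≤ f p := fun p => (hf01 p).1
  -- (a) `∫ f dμ_n ≤ b`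
  have hlin : ∀ μ : Measure (ℝ × ℝ), ∫⁻ p, ENNReal.ofReal (f p) ∂μ ≤ μ G := by
    intro μ
    calc ∫⁻ p, ENNReal.ofReal (f p) ∂μ ≤ ∫⁻ p, G.indicator 1 p ∂μ := by
          refine lintegral_mono fun p => ?_
          by_cases hp : p ∈ G
          · rw [indicator_of_mem hp, Pi.one_apply]; exact ENNReal.ofReal_le_one.2 (hf01 p).2
          · rw [indicator_of_notMem hp, image_eq_zero_of_notMem_tsupport (fun h' => hp (hfG h')), ENNReal.ofReal_zero]
      _ = μ G := lintegral_indicator_one hG.measurableSet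
  have hint_eq : ∀ μ : Measure (ℝ × ℝ), ∫ p, f p ∂μ = (∫⁻ p, ENNReal.ofReal (f p) ∂μ).toReal := fun μ =>
    integral_eq_lintegral_of_nonneg_ae (ae_of_all _ hf0) f.continuous.aestronglyMeasurable
  have ha : ∀ n, ∫ p, f p ∂μs n ≤ b := by
    intro n
    rw [hint_eq]
    have hGb : μs n G ≠ ⊤ := ((hle n).trans_lt ENNReal.ofReal_lt_top).ne
    exact (ENNReal.toReal_mono hGb (hlin _)).trans (ENNReal.toReal_le_of_le_ofReal hb (hle n))
  -- (b)-(c) the limit integral is `≤ b` by vague convergence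
  have hlim : ∫ p, f p ∂νlim ≤ b := le_of_tendsto' (hv f f.continuous hfsupp hfU) ha
  -- (d)-(e) `ν(K_j) ≤ ∫ f dν ≤ b`
  have hL : ∫⁻ p, ENNReal.ofReal (f p) ∂νlim ≠ ⊤ := by
    refine ne_of_lt (lt_of_le_of_lt ?_ (hfin (tsupport f) hfsupp.isCompact hfU))
    calc ∫⁻ p, ENNReal.ofReal (f p) ∂νlim ≤ ∫⁻ p, (tsupport f).indicator 1 p ∂νlim := by
          refine lintegral_mono fun p => ?_
          by_cases hp : p ∈ tsupport f
          · rw [indicator_of_mem hp, Pi.one_apply]; exact ENNReal.ofReal_le_one.2 (hf01 p).2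
          · rw [indicator_of_notMem hp, image_eq_zero_of_notMem_tsupport hp, ENNReal.ofReal_zero]
      _ = νlim (tsupport f) := lintegral_indicator_one (isClosed_tsupport _).measurableSet
  calc νlim (K j) = ∫⁻ p, (K j).indicator 1 p ∂νlim := (lintegral_indicator_one (hKc j).measurableSet).symm
    _ ≤ ∫⁻ p, ENNReal.ofReal (f p) ∂νlim := by
        refine lintegral_mono fun p => ?_
        by_cases hp : p ∈ K j
        · rw [indicator_of_mem hp, Pi.one_apply, hf1 hp, Pi.one_apply, ENNReal.ofReal_one]
        · rw [indicator_of_notMem hp]; exact zero_le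
    _ ≤ ENNReal.ofReal b := by
        rw [ENNReal.le_ofReal_iff_toReal_le hL hb, ← hint_eq]
        exact hlim

/-! ## 5. Lemma 31 (i): sequential compactness of `𝓜_{c,C}` -/

/-- **Lemma 31 (i) (properties of `𝓜`): `𝓜_{c,C}` is (sequentially) compact** (`c > 0`,
`C ≥ 0`): every sequence `(ν_n) ⊂ 𝓜_{c,C}` has a subsequence converging vaguely on
`ℝ_{>0} × ℝ` to some `ν ∈ 𝓜_{c,C}`. In particular convergence sequences (Definition 33) exist.
[cite: DKLM2026SixVertexGFF, Part II, Lemma 31 (i) and Definition 33] -/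
theorem dklmSpaceM_exists_subseq_vagueTendsto (hc : 0 < c) (hC : 0 ≤ C) {νs : ℕ → Measure (ℝ × ℝ)}
    (hνs : ∀ n, νs n ∈ dklmSpaceM c C) :
    ∃ φ : ℕ → ℕ, StrictMono φ ∧ ∃ ν : Measure (ℝ × ℝ), ν ∈ dklmSpaceM c C ∧ HalfPlaneVagueTendsto (νs ∘ φ) ν := by
  set W : ℕ → FiniteMeasure (ℝ × ℝ) := fun n => weightedFiniteMeasure (hνs n) with hW
  obtain ⟨φ, hφ, ρ, hρ⟩ := exists_subseq_tendsto_of_isTightMeasureSet W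
    (fun n => mass_weightedFiniteMeasure_le (hνs n)) (isTightMeasureSet_weighted hc hC hνs)
  have hρint : ∀ g : (ℝ × ℝ) →ᵇ ℝ,
      Tendsto (fun n => ∫ p, g p ∂((W (φ n) : FiniteMeasure (ℝ × ℝ)) : Measure (ℝ × ℝ))) atTop
        (𝓝 (∫ p, g p ∂(ρ : Measure (ℝ × ℝ)))) :=
    fun g => (FiniteMeasure.tendsto_iff_forall_integral_tendsto.1 hρ) g
  -- each weighted measure is reflection invariant, hence so is the weak limit `ρ`
  have hWR : ∀ n, (((W n : FiniteMeasure (ℝ × ℝ)) : Measure (ℝ × ℝ))).map reflectB = W n := by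
    intro n
    have hR : (νs n).map reflectB = νs n := dklmSpaceM_map_reflect (hνs n)
    show ((νs n).withDensity (weightW ∘ reflectB)).map reflectB = (νs n).withDensity weightW
    rw [map_withDensity_comp measurable_reflectB measurable_weightW, hR]
  have hkey : ∀ g : (ℝ × ℝ) →ᵇ ℝ,
      ∫ p, g p ∂((ρ : Measure (ℝ × ℝ)).map reflectB) = ∫ p, g p ∂(ρ : Measure (ℝ × ℝ)) := by
    intro g
    rw [integral_map measurable_reflectB.aemeasurable g.continuous.aestronglyMeasurable]
    have h1 := hρint (g.compContinuous reflectBC)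
    have h3 : ∀ n, ∫ p, g (reflectB p) ∂((W (φ n) : FiniteMeasure (ℝ × ℝ)) : Measure (ℝ × ℝ)) =
        ∫ p, g p ∂((W (φ n) : FiniteMeasure (ℝ × ℝ)) : Measure (ℝ × ℝ)) := by
      intro n
      calc ∫ p, g (reflectB p) ∂((W (φ n) : FiniteMeasure (ℝ × ℝ)) : Measure (ℝ × ℝ))
          = ∫ p, g p ∂((((W (φ n) : FiniteMeasure (ℝ × ℝ)) : Measure (ℝ × ℝ))).map reflectB) :=
            (integral_map measurable_reflectB.aemeasurable g.continuous.aestronglyMeasurable).symm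
        _ = _ := by rw [hWR]
    simp only [BoundedContinuousFunction.compContinuous_apply, reflectBC_apply] at h1
    simp only [h3] at h1
    exact tendsto_nhds_unique h1 (hρint g)
  have hρR' : ρ.map reflectB = ρ :=
    FiniteMeasure.ext_of_forall_integral_eq fun g => by rw [FiniteMeasure.toMeasure_map]; exact hkey g
  have hρR : ((ρ : FiniteMeasure (ℝ × ℝ)) : Measure (ℝ × ℝ)).map reflectB = ρ := by
    rw [← FiniteMeasure.toMeasure_map, hρR']
  -- vague convergence to the candidate limit
  have hvague : HalfPlaneVagueTendsto (νs ∘ φ) (vagueLimitMeasure (ρ : Measure (ℝ × ℝ))) := by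
    intro ψt hψc hψs hψU
    obtain ⟨ψb, hψb⟩ := exists_bcf_div_weight hψc hψs hψU
    have h1 : ∀ n, ∫ p, ψt p ∂(νs ∘ φ) n = ∫ p, ψb p ∂((W (φ n) : FiniteMeasure (ℝ × ℝ)) : Measure (ℝ × ℝ)) := by
      intro n
      simp only [Function.comp_apply, hψb]
      exact integral_eq_integral_withDensity_weightW _ hψU
    have h2 : ∫ p, ψt p ∂vagueLimitMeasure (ρ : Measure (ℝ × ℝ)) = ∫ p, ψb p ∂(ρ : Measure (ℝ × ℝ)) := by
      simp only [hψb]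
      exact integral_vagueLimitMeasure _ hψU
    simp only [h1, h2]
    exact hρint ψb
  refine ⟨φ, hφ, vagueLimitMeasure (ρ : Measure (ℝ × ℝ)), ⟨vagueLimitMeasure_nonpos _,
    vagueLimitMeasure_map_reflect hρR, fun α hα => ?_, fun α β hα hαβ => ?_⟩, hvague⟩
  · exact measure_le_of_halfPlaneVagueTendsto hvague
      (fun K hK hKU => vagueLimitMeasure_compact_lt_top _ hK hKU) (isOpen_Ioo.preimage continuous_fst)
      (fun p hp => hα.trans hp.1) hC (fun n => dklmSpaceM_bound_i (hνs (φ n)) hα)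
  · refine measure_le_of_halfPlaneVagueTendsto hvague
      (fun K hK hKU => vagueLimitMeasure_compact_lt_top _ hK hKU)
      ((isOpen_Ioo.preimage continuous_fst).inter (isOpen_Ioo.preimage (continuous_abs.comp continuous_snd)))
      (fun p hp => hp.1.1) (mul_nonneg hC (Real.rpow_nonneg (div_nonneg hα.le (hα.le.trans hαβ)) c))
      (fun n => dklmSpaceM_bound_ii (hνs (φ n)) hα hαβ)

/-! ## 6. Definition 33: convergence sequences exist -/

/-- **Definition 33 (Convergence sequence)** for a measure `μ_∞` (in the paper: a sub-sequential
limit of the `μ_L`): positive reals `δ_n → 0` along which `μ_∞^{(δ_n)}` converges (vaguely on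
`ℝ_{>0} × ℝ`) to the limit `μ`. [cite: DKLM2026SixVertexGFF, Part II, Definition 33] -/
def IsConvergenceSeq (μinf : Measure (ℝ × ℝ)) (δ : ℕ → ℝ) (μ : Measure (ℝ × ℝ)) : Prop :=
  (∀ n, 0 < δ n) ∧ Tendsto δ atTop (𝓝 0) ∧ HalfPlaneVagueTendsto (fun n => scaleMeasure (δ n) μinf) μ

/-- **Convergence sequences exist** ("by compactness of `𝓜`; moreover, from any sequence of
scales `(δ_n')_n` tending to zero, one may extract a convergence sub-sequence"): for
`μ_∞ ∈ 𝓜_{c,C}` and positive scales `δ'_n → 0` there are a subsequence `δ_n = δ'_{φ(n)}` and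
`μ ∈ 𝓜_{c,C}` forming a convergence sequence.
[cite: DKLM2026SixVertexGFF, Part II, Definition 33 and Lemma 31 (i)] -/
theorem exists_isConvergenceSeq_subseq (hc : 0 < c) (hC : 0 ≤ C) {μinf : Measure (ℝ × ℝ)}
    (hμ : μinf ∈ dklmSpaceM c C) {δ' : ℕ → ℝ} (hδ' : ∀ n, 0 < δ' n) (hδ'0 : Tendsto δ' atTop (𝓝 0)) :
    ∃ φ : ℕ → ℕ, StrictMono φ ∧ ∃ μ : Measure (ℝ × ℝ), μ ∈ dklmSpaceM c C ∧ IsConvergenceSeq μinf (δ' ∘ φ) μ := by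
  obtain ⟨φ, hφ, μ, hμM, hv⟩ :=
    dklmSpaceM_exists_subseq_vagueTendsto hc hC (fun n => scaleMeasure_mem_dklmSpaceM (hδ' n) hμ)
  exact ⟨φ, hφ, μ, hμM, fun n => hδ' (φ n), hδ'0.comp hφ.tendsto_atTop, hv⟩

end Literature.Probability.LatticeModels.SixVertex

end
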